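import Mathlib
import Literature.MathematicalPhysics.KineticTheory.HardSphereEuler
import Literature.Analysis.UnboundedOperators.LinearizedBoltzmann

/-!
# Sketch — crux-ideate `stmt-AtomisticToContinuum-14136` (`ShearStressHalfDrude`), round 1, ideator 1

First lemmas of the two idea cards (`fixed-budget-signed-hierarchy`, `velocity-resampling-cutoff`),
typed over existing declarations only. Nothing here is proved; every declaration is a `Prop`.

Frame (as in the crux): `N + 1` spheres of diameter `hsDiameter σ N = σ ℓ`, `ℓ = (N+1)^{-1/3}`, on
`𝕋³`; global Gibbs law `G_N = localGibbsLaw σ a u₀ θ N Φ` (constant profiles, flow-invariant);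
peculiar velocity `w = (v - u₀)/√θ ~ stdGaussian V3`; cutoff shear stress
`g_A(w) = ⟪e₁,w⟫⟪e₂,w⟫(1 - smoothTransition (‖w‖²/A² - 1))`, `e₁ ⊥ e₂`; kinetic time unit
`t₀ := ℓ/(σ²√θ)` (`= 4√π` mean free times, the unit of `BoltzmannGreenKubo`).
-/

open MeasureTheory ProbabilityTheory Set
open scoped InnerProductSpace

namespace Summit.AtomisticToContinuum.HydrodynamicLimit.Cruxes.ShearStressHalfDrude.IdeatorOne

open Literature.MathematicalPhysics.KineticTheory

noncomputable section

/-- Abbreviation: the phase space of `N + 1` spheres on `𝕋³`. -/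
abbrev Phase (N : ℕ) : Type :=
  Literature.Analysis.FluidPDE.Config (N + 1) (Fin 3) T3

/-- Abbreviation: the type of hard-sphere flows at reduced diameter `σ`, `N + 1` spheres. -/
abbrev Flow (σ : ℝ) (N : ℕ) : Type :=
  Literature.Analysis.FluidPDE.HardSphereFlow (Literature.Analysis.FluidPDE.Torus.geometry (Fin 3))
    (hsDiameter σ N) (N + 1)

/-- The crux's cutoff shear stress `g_A(w) = ⟪e₁,w⟫⟪e₂,w⟫ (1 - smoothTransition (‖w‖²/A² - 1))`. -/
def cutoffStress (e₁ e₂ : V3) (A : ℝ) (w : V3) : ℝ :=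
  ⟪e₁, w⟫_ℝ * ⟪e₂, w⟫_ℝ * (1 - Real.smoothTransition (‖w‖ ^ 2 / A ^ 2 - 1))

/-- The one-body additive observable `F(z) = Σ_i φ(x_i) g((v_i - u₀)/√θ)`. -/
def oneBody {N : ℕ} (θ : ℝ) (u₀ : V3) (φ : T3 → ℝ) (g : V3 → ℝ) (z : Phase N) : ℝ :=
  ∑ i, φ (z i).1 * g ((Real.sqrt θ)⁻¹ • ((z i).2 - u₀))

/-- Kinetic time unit `t₀ = ℓ/(σ²√θ)`, `ℓ = (N+1)^{-1/3}` (the unit of `BoltzmannGreenKubo`). -/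
def kineticUnit (σ θ : ℝ) (N : ℕ) : ℝ :=
  ((N + 1 : ℕ) : ℝ) ^ (-(1 / 3 : ℝ)) / (σ ^ 2 * Real.sqrt θ)

/-! ## Card 1 (`fixed-budget-signed-hierarchy`) -/

/-- **WindowBudget** (first lemma of card 1; abstract, provable now, size S/M). For a stationary
family of observables `t ↦ F ∘ T_t` on a probability space whose two-time products obey a ONE-SIDED
exponential envelope with an additive budget `η` up to the horizon `S`,
`E[F(T_t)F(T_s)] ≤ E[F²](e^{-λ(t-s)} + η)` for `0 ≤ s ≤ t ≤ S`, the window variance obeys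
`E[(S⁻¹∫₀^S F∘T_t)²] ≤ E[F²](2/(λS) + η)`. Proof: expand the square, Fubini (joint measurability is a
hypothesis), `2S⁻²∫₀^S∫₀^t (e^{-λ(t-s)} + η) ds dt ≤ 2/(λS) + η`. With `2/(λS) ≤ ¼`, `η = ¼` this is
the factor `½` of the crux: the horizon `S = 8/λ` is ABSOLUTE (λ = the proved Baranger–Mouhot gap)
and the validity input is needed only up to `S`, with a FIXED error budget `¼`. -/
def WindowBudget : Prop :=
  ∀ (X : Type) [MeasurableSpace X] (μ : Measure X) [IsProbabilityMeasure μ] (T : ℝ → X → X)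
    (F : X → ℝ), Measurable (Function.uncurry fun (t : ℝ) (x : X) => F (T t x)) →
    (∃ C : ℝ, ∀ x, |F x| ≤ C) →
    ∀ (lam η S : ℝ), 0 < lam → 0 ≤ η → 0 < S →
    (∀ s t : ℝ, 0 ≤ s → s ≤ t → t ≤ S →
      ∫ x, F (T t x) * F (T s x) ∂μ ≤ (∫ x, F x ^ 2 ∂μ) * (Real.exp (-(lam * (t - s))) + η)) →
    ∫ x, (S⁻¹ * ∫ t in (0 : ℝ)..S, F (T t x)) ^ 2 ∂μ ≤ (∫ x, F x ^ 2 ∂μ) * (2 / (lam * S) + η)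

/-- **StaticShearVariance** (support, provable now; verified on paper by two refuter passes on the
item): under the constant-profile Gibbs law the static variance of `F = Σ φ(x_i) g_A(w_i)` is EXACTLY
`(N+1)(∫φ²)(∫g_A² dγ)`: velocities are i.i.d. standard Gaussian in the peculiar frame and independent
of the positions, `g_A` is odd in `⟪e₁,w⟫` (mean zero, so cross terms vanish), and the one-particle
position marginal is Haar on `𝕋³` (translation invariance; unit volume). -/
def StaticShearVariance : Prop :=
  ∀ (a θ : ℝ) (u₀ : V3), 0 < a → 0 < θ → ∀ σ : ℝ, 0 < σ → σ ≤ 1 / 2 →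
    ∀ (N : ℕ) (Φ : Flow σ N) (e₁ e₂ : V3), ⟪e₁, e₂⟫_ℝ = 0 → ∀ A : ℝ, 0 < A →
    ∀ φ : T3 → ℝ, Continuous φ →
      ∫ z, oneBody θ u₀ φ (cutoffStress e₁ e₂ A) z ^ 2 ∂(localGibbsLaw σ (fun _ => a) (fun _ => u₀) (fun _ => θ) N Φ)
        = ((N : ℝ) + 1) * (∫ x, φ x ^ 2) * ∫ w, cutoffStress e₁ e₂ A w ^ 2 ∂(stdGaussian V3)

/-- **FixedDensityEnvelope** (card 1, TRANSFER target C⁺): at FIXED small reduced density the two-time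
autocorrelation of the cutoff shear stress over an arbitrary but FINITE kinetic horizon `S` lies below
the linearised-Boltzmann exponential envelope given by the proved spectral gap `λ`, up to an additive
budget `η`, uniformly in `N` and in the flow; `σ₀` depends on `(a, θ, u₀, η, S)` only — NOT on the
cutoff `A`, the directions, or the modulation `φ` (the A-uniformity at the slow end `A → 0` is what
card 2 supplies; for `A` in compacts and `A → ∞` it is the output of the fixed-budget BGSS engine).
Crux ⇐ C⁺: take `S = 8/λ`, `η = ¼`, `τ := S/(σ²√θ)` (so `h = τ ℓ = S t₀`), then `WindowBudget`
(with stationarity `HomogeneousInvariance`, item 9621) and `StaticShearVariance` give the factor `½`. -/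
def FixedDensityEnvelope : Prop :=
  ∀ (a θ : ℝ) (u₀ : V3), 0 < a → 0 < θ → ∃ lam : ℝ, 0 < lam ∧ ∀ (η S : ℝ), 0 < η → 0 < S →
    ∃ σ₀ : ℝ, 0 < σ₀ ∧ ∀ σ : ℝ, 0 < σ → σ < σ₀ →
    (∀ (N : ℕ) (Φ : Flow σ N), IsProbabilityMeasure (localGibbsLaw σ (fun _ => a) (fun _ => u₀) (fun _ => θ) N Φ)) ∧
    ∀ (e₁ e₂ : V3), ⟪e₁, e₂⟫_ℝ = 0 → ∀ A : ℝ, 0 < A → ∀ φ : T3 → ℝ, Continuous φ →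
    ∃ N₀ : ℕ, ∀ N : ℕ, N₀ ≤ N → ∀ (Φ : Flow σ N) (t : ℝ), t ∈ Icc 0 S →
      ∫ z, oneBody θ u₀ φ (cutoffStress e₁ e₂ A) (Φ.flow (t * kineticUnit σ θ N) z)
            * oneBody θ u₀ φ (cutoffStress e₁ e₂ A) z
          ∂(localGibbsLaw σ (fun _ => a) (fun _ => u₀) (fun _ => θ) N Φ)
        ≤ ((N : ℝ) + 1) * (∫ x, φ x ^ 2) * (∫ w, cutoffStress e₁ e₂ A w ^ 2 ∂(stdGaussian V3))
            * (Real.exp (-(lam * t)) + η)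

/-! ## Card 2 (`velocity-resampling-cutoff`) -/

/-- The kinetic-window variance functional of the crux, as a function of the velocity observable `g`
(window `h`, modulation `φ`). -/
def windowVar {N : ℕ} (σ a θ : ℝ) (u₀ : V3) (Φ : Flow σ N) (φ : T3 → ℝ) (h : ℝ)
    (g : V3 → ℝ) : ℝ :=
  ∫ z, (h⁻¹ * ∫ s in (0 : ℝ)..h, oneBody θ u₀ φ g (Φ.flow s z)) ^ 2
    ∂(localGibbsLaw σ (fun _ => a) (fun _ => u₀) (fun _ => θ) N Φ)

/-- **CutoffContinuity** (card 2, step (i), provable now, size M): for MEAN-ZERO velocity observables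
the window variance is `2`-Lipschitz in `g ∈ L²(γ)` with constant `(N+1)∫φ²`, uniformly in `N`, `h`,
`σ`, `Φ`: the window average is a contraction of `L²(G_N)` (Jensen in time + invariance of `G_N`) and
`‖Σ_i φ(x_i) k(w_i)‖²_{L²(G_N)} = (N+1)(∫φ²)‖k‖²_γ` for mean-zero `k` (as in `StaticShearVariance`).
Consequence: `A ↦ windowVar(g_A)/((N+1)∫φ²‖g_A‖²)` is continuous on `(0, ∞]` uniformly in everything
(`g_A/‖g_A‖ → w¹w²` in `L²(γ)` as `A → ∞`), so the quantifier `∀ A` after `∃ σ₀` reduces to compact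
`A`-ranges, the Gaussian polynomial `w¹w²`, and the single singular end `A → 0`. -/
def CutoffContinuity : Prop :=
  ∀ (a θ : ℝ) (u₀ : V3), 0 < a → 0 < θ → ∀ σ : ℝ, 0 < σ → σ ≤ 1 / 2 →
    ∀ (N : ℕ) (Φ : Flow σ N) (φ : T3 → ℝ), Continuous φ → ∀ h : ℝ, 0 < h →
    ∀ g g' : V3 → ℝ, Continuous g → Continuous g' →
    (∃ C, ∀ w, |g w| ≤ C) → (∃ C, ∀ w, |g' w| ≤ C) →
    ∫ w, g w ∂(stdGaussian V3) = 0 → ∫ w, g' w ∂(stdGaussian V3) = 0 →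
      |windowVar σ a θ u₀ Φ φ h g - windowVar σ a θ u₀ Φ φ h g'|
        ≤ ((N : ℝ) + 1) * (∫ x, φ x ^ 2)
          * (Real.sqrt (∫ w, g w ^ 2 ∂(stdGaussian V3)) + Real.sqrt (∫ w, g' w ^ 2 ∂(stdGaussian V3)))
          * Real.sqrt (∫ w, (g w - g' w) ^ 2 ∂(stdGaussian V3))

/-- **SlowCutoffDistinctVanishes** (card 2, TRANSFER target for the DISTINCT part at the slow end;
the load-bearing new statement): for the slow cutoff `A ≤ A₀(η, S, σ)` the distinct-particle part of
the two-time shear-stress covariance, `(N+1)·N·E_{G_N}[g_A(w₁(t t₀)) g_A(w₂(0))]` (here with `φ = 1`;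
a macroscopic `φ` re-enters as `∫φ²` by translation invariance and locality), is at most `η` times the
static variance `(N+1)‖g_A‖²_γ`, uniformly in `N`, the flow and `t ≤ S`. Mechanism: resample `w₂`
(exact Efron–Stein identity from the product-Gaussian velocity law of `G_N`), so only particles `2` in
the backward cluster of `1` contribute; a slow `2` is quasi-static, which frees one factor
`γ(|w| ≤ √2·A)`; the law conditioned on "`1` slow at time `t`" is dominated by `γ(|w| ≤ √2 A)⁻¹ × G_N`,
so equilibrium TAIL bounds on backward-cluster cardinalities over the horizon `S` give the second small
factor up to a logarithm. `A₀` depends on `(η, S)` only — NOT on `σ` — which is what lets the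
slow end glue to the card-1 engine at an absolute hand-off cutoff. -/
def SlowCutoffDistinctVanishes : Prop :=
  ∀ (a θ : ℝ) (u₀ : V3), 0 < a → 0 < θ → ∃ σ₀ : ℝ, 0 < σ₀ ∧
    ∀ (η S : ℝ), 0 < η → 0 < S → ∃ A₀ : ℝ, 0 < A₀ ∧ ∀ σ : ℝ, 0 < σ → σ < σ₀ →
    ∀ A : ℝ, 0 < A → A ≤ A₀ →
    ∀ (e₁ e₂ : V3), ⟪e₁, e₂⟫_ℝ = 0 → ‖e₁‖ = 1 → ‖e₂‖ = 1 →
    ∃ N₀ : ℕ, ∀ N : ℕ, N₀ ≤ N → ∀ (Φ : Flow σ N) (t : ℝ), t ∈ Icc 0 S →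
      ∀ i j : Fin (N + 1), i ≠ j →
      |((N : ℝ) + 1) * (N : ℝ) *
          ∫ z, cutoffStress e₁ e₂ A ((Real.sqrt θ)⁻¹ • ((Φ.flow (t * kineticUnit σ θ N) z i).2 - u₀))
                * cutoffStress e₁ e₂ A ((Real.sqrt θ)⁻¹ • ((z j).2 - u₀))
            ∂(localGibbsLaw σ (fun _ => a) (fun _ => u₀) (fun _ => θ) N Φ)|
        ≤ η * (((N : ℝ) + 1) * ∫ w, cutoffStress e₁ e₂ A w ^ 2 ∂(stdGaussian V3))

/-- Linearised collision frequency `ν(v) = ∫∫ ((v - w)·ω)_+ dω dγ(w)` (the loss multiplier of the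
linearised hard-sphere operator; same kernel and angular measure as `hardSphereLinearizedOp`). -/
def collFreq (v : V3) : ℝ :=
  ∫ w, ∫ ω, hardSphereKernel (v, w) ω ∂sphereMeasure ∂(stdGaussian V3)

/-- **SlowBallPureLoss** (card 2, kinetic anchor, provable now, size M): on the slow cutoff stresses
the linearised hard-sphere operator acts as PURE LOSS, `‖(L + ν)g_A‖_γ ≤ η ‖g_A‖_γ` for `A ≤ A₀(η)`:
every gain/partner term needs an outgoing slow velocity (phase volume `O(A³)`), and `g_A ⊥ 1, w`
kills the first two Taylor orders of the partner-loss term; hence on the Boltzmann side the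
normalised autocorrelation of `g_A` tends to `e^{-ν(0) t}` as `A → 0` (sitting-duck relaxation at the
rate `ν(0) > 0`, cf. the proved `collisionFrequency_zero_pos`), and the linearised-Boltzmann window
fraction is bounded uniformly in `A` — the kinetic-side half of the A-uniformity. -/
def SlowBallPureLoss : Prop :=
  ∀ η : ℝ, 0 < η → ∃ A₀ : ℝ, 0 < A₀ ∧ ∀ A : ℝ, 0 < A → A ≤ A₀ →
    ∀ (e₁ e₂ : V3), ⟪e₁, e₂⟫_ℝ = 0 → ‖e₁‖ = 1 → ‖e₂‖ = 1 →
      Literature.Analysis.UnboundedOperators.maxwellianInner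
          (fun v => Literature.Analysis.UnboundedOperators.hardSphereLinearizedOp (E := V3)
              (cutoffStress e₁ e₂ A) v + collFreq v * cutoffStress e₁ e₂ A v)
          (fun v => Literature.Analysis.UnboundedOperators.hardSphereLinearizedOp (E := V3)
              (cutoffStress e₁ e₂ A) v + collFreq v * cutoffStress e₁ e₂ A v)
        ≤ η ^ 2 * Literature.Analysis.UnboundedOperators.maxwellianInner
            (cutoffStress e₁ e₂ A) (cutoffStress e₁ e₂ A)

end

end Summit.AtomisticToContinuum.HydrodynamicLimit.Cruxes.ShearStressHalfDrude.IdeatorOne
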